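/-
Copyright (c) 2026. All rights reserved.
Released under Apache 2.0 license as described in the file LICENSE.
Authors: abc-iut cell, cone prover seat abc-iut-w6-d031 (gen 4; UNIF Tier-2 brick P7 «uniformised-base
junction», part 2: plane domains and the thrice-punctured sphere are `ℍ/Λ̄`-s of `HolRS`, unconditionally).
-/
import Literature.AnabelianGeometry.AbsoluteAnabelian.ArchimedeanHolFieldFunctorGeometricPSLUniformisedBase
import Literature.AnabelianGeometry.AbsoluteAnabelian.ArchimedeanHolFieldFunctorGeometricOverIdRigidInstances
import HarnessLib

/-!
# Plane domains omitting two points — in particular `ℙ¹ ∖ {0, 1, ∞}` — are `ℍ/Λ̄`-s of `HolRS` (PROOF-ONLY)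

Topic `Literature/AnabelianGeometry/AbsoluteAnabelian`; part 2 of the uniformised-base junction
`ArchimedeanHolFieldFunctorGeometricPSLUniformisedBase` (campaign-L support for the geometric column
of [AbsTopIII] Prop 4.2 (i) / Cor 4.5, S. Mochizuki, *Topics in absolute anabelian geometry III*, proof
of Prop 4.2 (i), kurims p.106 l.11–19; Def 4.1 (i) p.101: the objects of `EA` are hyperbolic Riemann
surfaces such as `ℙ¹ ∖ {0, 1, ∞}`).  Classical input: the uniformization of plane domains (Koebe–Poincaré;
Fisher–Hubbard–Wittner 1988, Theorem p.413: «if `U ⊂ ℂ` is a connected open set whose complement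
contains at least two points, then the universal covering space of `U` is the disc»), which is a tree
THEOREM `Complex.planeDomainDiscCovering_holds` (abc-iut-w5-d089, programme «UNIF-G1P» Tier 1), and
Farkas–Kra IV.5.5–IV.5.6 (`M = M̃/G`, `Aut U ≅ PSL(2, ℝ)`) in the form of part 1's
`HolRS.exists_pslQuotient_iso_of_disc_cover`.

* `HolRS.exists_disc_cover_ofOpen` — a holomorphic covering map `unitDiscOpens → U` onto every connected
  open `U ⊆ ℂ` omitting two points, in the `Opens`-typed currency of `HolRS.ofOpen` (repackaging of
  `Complex.planeDomainDiscCovering_holds`; private subtype plumbing `mdifferentiable_opens_of_coe_eq`);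
* ★ `HolRS.exists_pslQuotient_iso_ofOpen` — **every connected open `U ⊆ ℂ` omitting two points is an
  `ℍ/Λ̄` in `HolRS`**, `Λ̄ ≤ PSL₂(ℝ)` acting freely and properly discontinuously, `Λ̄ ≃* π₁(U)` —
  UNCONDITIONAL;
* `HolRS.exists_pslQuotient_iso_planeComplFinite` — **`ℂ ∖ F` for `F` finite with `2 ≤ |F|`**
  (abc-iut-L4-t12's `HolRS.planeComplFinite`), and
  ★ `HolRS.exists_pslQuotient_iso_thricePuncturedSphere` — **the thrice-punctured sphere
  `ℙ¹ ∖ {0, 1, ∞} = ℂ ∖ {0, 1}` is an `ℍ/Λ̄` in `HolRS`**, unconditionally.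

Everything is a theorem; no definition, no instance, no named fact.  HONEST FRAMING: classical;
MODEL ≠ reconstruction; nothing here bears on the disputed [IUTchIII] Cor. 3.12.

## References

* S. Mochizuki, *Topics in Absolute Anabelian Geometry III* (2015), Def. 4.1 (i) p.101, proof of
  Prop. 4.2 (i) p.106. [MochizukiAbsTopIII2015]
* Y. Fisher, J. H. Hubbard, B. S. Wittner, *A proof of the uniformization theorem for arbitrary plane
  domains*, Proc. AMS 104 (1988) 413–418, Theorem p.413. [FisherHubbardWittner1988]
* H. M. Farkas, I. Kra, *Riemann Surfaces*, 2nd ed. (1992), IV.5.5–IV.5.6. [FarkasKra1992]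
-/

set_option autoImplicit false

noncomputable section

namespace Literature.AnabelianGeometry.AbsoluteAnabelian

namespace HolRS

open scoped _root_.Manifold _root_.ContDiff _root_.Topology UpperHalfPlane
open _root_.MulAction _root_.Function _root_.Set _root_.CategoryTheory _root_.TopologicalSpace
open _root_.Metric

/-! ### §1 The disc covers every plane domain omitting two points (`Opens`-typed) -/

/-- A map between open subsets of Riemann surfaces whose composite with the inclusions is, at every
point, a differentiable map of the ambient surfaces is holomorphic (local restatement of a standard
subtype fact, via Mathlib's `liftPropAt_iff_comp_subtype_val` / `liftPropWithinAt_subtypeVal_comp_iff`).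
[folklore] -/
private theorem mdifferentiable_opens_of_coe_eq {M : Type} [TopologicalSpace M] [ChartedSpace ℂ M]
    {M' : Type} [TopologicalSpace M'] [ChartedSpace ℂ M'] {U : Opens M} {V : Opens M'} {g : M → M'}
    (e : U → V) (he : ∀ x : U, (e x : M') = g x)
    (hg : ∀ x : U, MDifferentiableAt 𝓘(ℂ, ℂ) 𝓘(ℂ, ℂ) g x) : MDifferentiable 𝓘(ℂ, ℂ) 𝓘(ℂ, ℂ) e := by
  intro x
  have h1 : MDifferentiableAt 𝓘(ℂ, ℂ) 𝓘(ℂ, ℂ) (Subtype.val ∘ e) x ↔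
      MDifferentiableAt 𝓘(ℂ, ℂ) 𝓘(ℂ, ℂ) e x :=
    ChartedSpace.liftPropWithinAt_subtypeVal_comp_iff ..
  rw [← h1]
  have h2 : (Subtype.val ∘ e) = fun x : U => g x := funext fun x => he x
  rw [h2]
  exact ((differentiableWithinAt_localInvariantProp (I := 𝓘(ℂ, ℂ))
    (I' := 𝓘(ℂ, ℂ))).liftPropAt_iff_comp_subtype_val _ _).symm.mpr (hg x)

/-- **The unit disc holomorphically covers every connected open `U ⊆ ℂ` omitting two points**
(Fisher–Hubbard–Wittner 1988, Theorem p.413), in the `Opens`-typed currency of `HolRS.ofOpen`: a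
surjective holomorphic covering map `unitDiscOpens → U` — the tree theorem
`Complex.planeDomainDiscCovering_holds`, repackaged. [cite: FisherHubbardWittner1988, Theorem p.413] -/
theorem exists_disc_cover_ofOpen (U : Opens ℂ) (hU : IsConnected (U : Set ℂ))
    (hab : ∃ a b : ℂ, a ≠ b ∧ a ∉ (U : Set ℂ) ∧ b ∉ (U : Set ℂ)) :
    ∃ p : unitDiscOpens → (ofOpen U hU).carrier,
      IsCoveringMap p ∧ Surjective p ∧ MDifferentiable 𝓘(ℂ, ℂ) 𝓘(ℂ, ℂ) p := by
  obtain ⟨f, hf, hsurj, hmaps, hcov⟩ := Complex.planeDomainDiscCovering_holds (U : Set ℂ) U.2 hU hab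
  let p : unitDiscOpens → (ofOpen U hU).carrier := fun w => ⟨f (w : ℂ), hmaps w.2⟩
  have hp : IsCoveringMap p := hcov
  refine ⟨p, hp, fun u => ?_, ?_⟩
  · obtain ⟨z, hz, hzu⟩ := hsurj u.2
    exact ⟨⟨z, hz⟩, Subtype.ext hzu⟩
  · refine mdifferentiable_opens_of_coe_eq (g := f) p (fun _ => rfl) fun w => ?_
    have hfw : DifferentiableAt ℂ f (w : ℂ) :=
      hf.differentiableAt (isOpen_ball.mem_nhds (mem_ball_zero_iff.mpr (mem_ball_zero_iff.mp w.2)))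
    exact hfw.mdifferentiableAt

/-! ### §2 Plane domains omitting two points are `ℍ/Λ̄`-s -/

/-- ★ **Every connected open `U ⊆ ℂ` omitting two points is an `ℍ/Λ̄` in `HolRS`** — UNCONDITIONAL:
there are a holomorphic covering map `k : ℍ → U`, its Möbius deck group `Λ̄ ≤ PSL₂(ℝ)` (membership
criterion `k ∘ (q • ·) = k`) acting freely and properly discontinuously with `k` its quotient covering
map and `π₁(U) ≃* Λ̄`, and an ISOMORPHISM `pslQuotient Λ̄ ≅ HolRS.ofOpen U` of `HolRS`, `[τ] ↦ k τ`
(`exists_disc_cover_ofOpen` + part 1's `exists_pslQuotient_iso_of_disc_cover`).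
[cite: FisherHubbardWittner1988, Theorem p.413] [cite: FarkasKra1992, IV.5.5–IV.5.6] -/
theorem exists_pslQuotient_iso_ofOpen (U : Opens ℂ) (hU : IsConnected (U : Set ℂ))
    (hab : ∃ a b : ℂ, a ≠ b ∧ a ∉ (U : Set ℂ) ∧ b ∉ (U : Set ℂ)) :
    ∃ (k : ℍ → (ofOpen U hU).carrier) (Λ : Subgroup PSL2R) (_ : ProperlyDiscontinuousSMul Λ ℍ)
      (_ : IsCancelSMul Λ ℍ),
      IsCoveringMap k ∧ MDifferentiable 𝓘(ℂ, ℂ) 𝓘(ℂ, ℂ) k ∧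
      (∀ q : PSL2R, q ∈ Λ ↔ ∀ τ : ℍ, k (q • τ) = k τ) ∧
      IsQuotientCoveringMap k Λ ∧
      (∀ x : (ofOpen U hU).carrier, Nonempty (FundamentalGroup (ofOpen U hU).carrier x ≃* Λ)) ∧
      ∃ e : pslQuotient Λ ≅ ofOpen U hU,
        ∀ τ : ℍ, e.hom.toFun (Quotient.mk (orbitRel Λ ℍ) τ) = k τ := by
  obtain ⟨p, hp, -, dp⟩ := exists_disc_cover_ofOpen U hU hab
  obtain ⟨k, Λ, hPD, hC, hk, dk, -, hΛ, hq, hπ, e, he⟩ :=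
    exists_pslQuotient_iso_of_disc_cover (ofOpen U hU) hp dp
  exact ⟨k, Λ, hPD, hC, hk, dk, hΛ, hq, hπ, e, he⟩

/-- **`ℂ ∖ F` is an `ℍ/Λ̄` in `HolRS` for every finite `F ⊆ ℂ` with at least two points** — UNCONDITIONAL
(abc-iut-L4-t12's object `HolRS.planeComplFinite F hF`; the hyperbolic curves of type `(0, |F| + 1)`).
[cite: MochizukiAbsTopIII2015, Definition 4.1 (i) p.101] [cite: FisherHubbardWittner1988, Theorem p.413] -/
theorem exists_pslQuotient_iso_planeComplFinite {F : Set ℂ} (hF : F.Finite) (h2 : 2 ≤ F.ncard) :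
    ∃ (k : ℍ → (planeComplFinite F hF).carrier) (Λ : Subgroup PSL2R)
      (_ : ProperlyDiscontinuousSMul Λ ℍ) (_ : IsCancelSMul Λ ℍ),
      IsCoveringMap k ∧ MDifferentiable 𝓘(ℂ, ℂ) 𝓘(ℂ, ℂ) k ∧
      (∀ q : PSL2R, q ∈ Λ ↔ ∀ τ : ℍ, k (q • τ) = k τ) ∧
      IsQuotientCoveringMap k Λ ∧
      (∀ x : (planeComplFinite F hF).carrier,
        Nonempty (FundamentalGroup (planeComplFinite F hF).carrier x ≃* Λ)) ∧
      ∃ e : pslQuotient Λ ≅ planeComplFinite F hF,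
        ∀ τ : ℍ, e.hom.toFun (Quotient.mk (orbitRel Λ ℍ) τ) = k τ := by
  obtain ⟨a, ha, b, hb, hab⟩ := (Set.one_lt_ncard hF).mp (lt_of_lt_of_le one_lt_two h2)
  exact exists_pslQuotient_iso_ofOpen ⟨Fᶜ, hF.isClosed.isOpen_compl⟩ (isConnected_compl_finite hF)
    ⟨a, b, hab, fun h => h ha, fun h => h hb⟩

/-- ★ **The thrice-punctured sphere `ℙ¹ ∖ {0, 1, ∞} = ℂ ∖ {0, 1}` is an `ℍ/Λ̄` in `HolRS`** —
UNCONDITIONAL: a holomorphic covering map `k : ℍ → ℂ ∖ {0, 1}`, its Möbius deck group `Λ̄ ≤ PSL₂(ℝ)`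
acting freely and properly discontinuously with `k` its quotient covering map and
`π₁(ℂ ∖ {0, 1}) ≃* Λ̄`, and an isomorphism `pslQuotient Λ̄ ≅ planeComplFinite {0, 1}` of `HolRS`.
[cite: MochizukiAbsTopIII2015, Definition 4.1 (i) p.101] [cite: FisherHubbardWittner1988, Theorem p.413] -/
theorem exists_pslQuotient_iso_thricePuncturedSphere :
    ∃ (k : ℍ → (planeComplFinite ({0, 1} : Set ℂ) (Set.toFinite _)).carrier) (Λ : Subgroup PSL2R)
      (_ : ProperlyDiscontinuousSMul Λ ℍ) (_ : IsCancelSMul Λ ℍ),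
      IsCoveringMap k ∧ MDifferentiable 𝓘(ℂ, ℂ) 𝓘(ℂ, ℂ) k ∧
      (∀ q : PSL2R, q ∈ Λ ↔ ∀ τ : ℍ, k (q • τ) = k τ) ∧
      IsQuotientCoveringMap k Λ ∧
      (∀ x : (planeComplFinite ({0, 1} : Set ℂ) (Set.toFinite _)).carrier,
        Nonempty (FundamentalGroup (planeComplFinite ({0, 1} : Set ℂ) (Set.toFinite _)).carrier x ≃* Λ)) ∧
      ∃ e : pslQuotient Λ ≅ planeComplFinite ({0, 1} : Set ℂ) (Set.toFinite _),
        ∀ τ : ℍ, e.hom.toFun (Quotient.mk (orbitRel Λ ℍ) τ) = k τ :=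
  exists_pslQuotient_iso_planeComplFinite (Set.toFinite _) (by rw [Set.ncard_pair (zero_ne_one' ℂ)])

end HolRS

end Literature.AnabelianGeometry.AbsoluteAnabelian

end
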